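import Mathlib
import HarnessLib
import Summits.Parity.GeneralizedHardyLittlewood.Theorems.LeeYangFibresAbsoluteUpgradeModGammaDefs
import Summits.Parity.GeneralizedHardyLittlewood.Theorems.LeeYangFibresModelHyperbolicityCalculus

/-!
# Route `LeeYangFibres`, crux `AbsoluteUpgrade` (stmt-Parity-14116), line `dip-margin-rate-exchange`:
# stub `mg_invariantConst` of the ADJOINT METHOD — constancy of the invariant along the row

We prove the registered stub `mg_invariantConst : MGAdjointEq → MGInvariantConst` (vocabulary file
`LeeYangFibresAbsoluteUpgradeModGammaDefs.lean`): for `N ≥ 1`, `|z| ≤ N − 1`, `u ≥ 3` and `1 ≤ v ≤ u − 1`,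

  `v K(v) g̃_z(v) + z ∫_{v−1}^{v} K(t) g̃_z(t+1) dt = g̃_z(1) + z ∫_0^1 g̃_z(t+1) dt`,

where `K = rowFn u z` is the Buchstab–Dickman row `K(v) = G_u(v+1; z)` and `g̃_z = adjTilde N z` is the
regularised `Γ`-normalised adjoint.  This is one-variable calculus (the real-variable ADJOINT METHOD of the
sieve literature, Greaves 2001 §4.2): the only inputs are

* the ADJOINT EQUATION `(v g̃(v))' = −z g̃(v+1)` for `v > 0` — the hypothesis `MGAdjointEq` (it also gives
  the continuity of `g̃` on `(0, ∞)`, `g̃ = (v g̃)/v`);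
* the DELAY EQUATION of the row, `v K'(v) = z K(v−1)` for `1 < v ≤ u` — the tree's `DensityCalculus` (C6)
  (`WindowChainTransport.calc_hasDerivAt_modelEval`, shifted from `τ` to `v = τ − 1`), and the continuity of
  `K` (C5) (`calc_continuous_modelEval`);
* `K ≡ 1` on `(−∞, 1]` (`rowFn_eq_one`, vocabulary file).

The heart is the abstract lemma `mgInv_invariant_eq` (arbitrary `K`, `g` with these three properties):
writing `∫_{v−1}^{v} = ∫_0^{v} − ∫_0^{v−1}` (FTC for a moving window,
`intervalIntegral.integral_hasDerivAt_right`), the invariant `Φ(v) = v K g̃ + z ∫_{v−1}^{v} K g̃(·+1)` has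
derivative `K'·(v g̃) + K·(v g̃)' + z[K(v) g̃(v+1) − K(v−1) g̃(v)] = z K(v−1) g̃(v) − z K(v) g̃(v+1)
+ z K(v) g̃(v+1) − z K(v−1) g̃(v) = 0` on `(1, u−1]`; it is continuous at `v = 1`; so it is constant on
`[1, u−1]` (`constant_of_has_deriv_right_zero` on `[a, v]` for `a ↓ 1`), and at `v = 1` it equals
`g̃(1) + z ∫_0^1 g̃(t+1) dt` because `K ≡ 1` on `[0, 1]`.

References: Greaves 2001 §4.2 (adjoint functions of the sieve delay equations) [Greaves2001]; tree templates
`Literature/NumberTheory/Sieve/SieveAdjointP.lean`, `DelayEquationDecay.lean`.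
-/

noncomputable section

namespace Summit.Parity.GeneralizedHardyLittlewood.Cruxes.AbsoluteUpgrade.DipMarginRateExchange

open scoped BigOperators Topology
open MeasureTheory Set Filter
open Summit.Parity.GeneralizedHardyLittlewood.Cruxes.ModelHyperbolicity.WindowChainTransport
  (modelEval calc_continuous_modelEval calc_hasDerivAt_modelEval)

/-! ## The abstract invariant lemma -/

/-- Continuity of the adjoint on `(0, ∞)` from the adjoint equation: if `w ↦ w g(w)` is differentiable at
every `w > 0` then `g = (w g)/w` is continuous at every `w > 0`. -/
theorem mgInv_continuousAt_of_adjointEq {g : ℝ → ℂ} {z : ℂ}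
    (hg : ∀ w : ℝ, 0 < w → HasDerivAt (fun x : ℝ => (x : ℂ) * g x) (-z * g (w + 1)) w)
    {w : ℝ} (hw : 0 < w) : ContinuousAt g w := by
  have h1 : ContinuousAt (fun x : ℝ => (x : ℂ) * g x) w := (hg w hw).continuousAt
  have h2 : ContinuousAt (fun x : ℝ => ((x : ℂ))⁻¹ * ((x : ℂ) * g x)) w :=
    (Complex.continuous_ofReal.continuousAt.inv₀ (Complex.ofReal_ne_zero.mpr hw.ne')).mul h1
  refine h2.congr ?_
  filter_upwards [Ioi_mem_nhds hw] with x hx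
  rw [inv_mul_cancel_left₀ (Complex.ofReal_ne_zero.mpr (ne_of_gt hx))]

/-- **The invariant of the adjoint method (abstract form).** If `K` is continuous, `K ≡ 1` on `(−∞, 1]`,
`K` satisfies the delay equation `v K'(v) = z K(v−1)` at every `v ∈ (1, b]`, and `g` satisfies the ADJOINT
equation `(v g(v))' = −z g(v+1)` at every `v > 0`, then
`⟨K, g⟩(v) := v K(v) g(v) + z ∫_{v−1}^{v} K(t) g(t+1) dt` is constant on `[1, b]`, equal to its value
`g(1) + z ∫_0^1 g(t+1) dt` at `v = 1`: its derivative on `(1, b]` is `K(v)[(v g)'(v) + z g(v+1)] = 0`, and it is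
continuous at `v = 1`. -/
theorem mgInv_invariant_eq {K g : ℝ → ℂ} {z : ℂ} {b : ℝ}
    (hKc : Continuous K) (hK1 : ∀ t : ℝ, t ≤ 1 → K t = 1)
    (hKd : ∀ w : ℝ, 1 < w → w ≤ b → HasDerivAt K (z * K (w - 1) / (w : ℂ)) w)
    (hg : ∀ w : ℝ, 0 < w → HasDerivAt (fun x : ℝ => (x : ℂ) * g x) (-z * g (w + 1)) w)
    {v : ℝ} (hv1 : 1 ≤ v) (hvb : v ≤ b) :
    (v : ℂ) * K v * g v + z * ∫ t in (v - 1)..v, K t * g (t + 1) =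
      g 1 + z * ∫ t in (0 : ℝ)..1, g (t + 1) := by
  -- continuity of `g` on `(0, ∞)`
  have hgc : ∀ w : ℝ, 0 < w → ContinuousAt g w := fun w hw => mgInv_continuousAt_of_adjointEq hg hw
  -- the integrand
  set F : ℝ → ℂ := fun t => K t * g (t + 1) with hF
  have hFc : ∀ t : ℝ, -1 < t → ContinuousAt F t := fun t ht =>
    hKc.continuousAt.mul
      ((hgc (t + 1) (by linarith)).comp' (f := fun s : ℝ => s + 1) (continuous_add_const 1).continuousAt)
  have hFco : ContinuousOn F (Ioi (-1)) := fun t ht => (hFc t ht).continuousWithinAt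
  have hFi : ∀ a c : ℝ, -1 < a → -1 < c → IntervalIntegrable F volume a c := fun a c ha hc =>
    (hFco.mono fun t ht => lt_of_lt_of_le (lt_min ha hc) ht.1).intervalIntegrable
  have hFm : ∀ t : ℝ, -1 < t → StronglyMeasurableAtFilter F (𝓝 t) := fun t ht =>
    hFco.stronglyMeasurableAtFilter isOpen_Ioi t ht
  -- the primitive `w ↦ ∫_0^w F` is differentiable at every `w > -1`
  have hP : ∀ w : ℝ, -1 < w → HasDerivAt (fun x => ∫ t in (0 : ℝ)..x, F t) (F w) w := fun w hw =>
    intervalIntegral.integral_hasDerivAt_right (hFi 0 w (by norm_num) hw) (hFm w hw) (hFc w hw)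
  -- the invariant, rewritten with the primitive
  set Ψ : ℝ → ℂ := fun w => K w * ((w : ℂ) * g w) +
      z * ((∫ t in (0 : ℝ)..w, F t) - ∫ t in (0 : ℝ)..(w - 1), F t) with hΨ
  have hΨd : ∀ w : ℝ, 0 < w → ∀ K' : ℂ, HasDerivAt K K' w →
      HasDerivAt Ψ (K' * ((w : ℂ) * g w) + K w * (-z * g (w + 1)) + z * (F w - F (w - 1))) w := by
    intro w hw K' hK'
    have h1 := hK'.mul (hg w hw)
    have h2 := ((hP w (by linarith)).sub ((hP (w - 1) (by linarith)).comp_sub_const w 1)).const_mul z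
    exact h1.add h2
  have hΦΨ : ∀ w : ℝ, 0 < w →
      (w : ℂ) * K w * g w + z * ∫ t in (w - 1)..w, F t = Ψ w := by
    intro w hw
    simp only [hΨ]
    rw [intervalIntegral.integral_interval_sub_left (hFi 0 w (by norm_num) (by linarith))
      (hFi 0 (w - 1) (by norm_num) (by linarith))]
    ring
  -- the derivative of the invariant vanishes on `(1, b]`
  have hΨ0 : ∀ w : ℝ, 1 < w → w ≤ b → HasDerivAt Ψ 0 w := by
    intro w hw hwb
    refine (hΨd w (by linarith) _ (hKd w hw hwb)).congr_deriv ?_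
    have hw0 : (w : ℂ) ≠ 0 := Complex.ofReal_ne_zero.mpr (by positivity)
    simp only [hF, sub_add_cancel]
    field_simp
    ring
  -- the invariant is continuous at `v = 1`
  have hΨc : ContinuousAt Ψ 1 := by
    have h1 : ContinuousAt (fun w : ℝ => K w * ((w : ℂ) * g w)) 1 :=
      hKc.continuousAt.mul (hg 1 one_pos).continuousAt
    have h2 : ContinuousAt
        (fun w : ℝ => z * ((∫ t in (0 : ℝ)..w, F t) - ∫ t in (0 : ℝ)..(w - 1), F t)) 1 :=
      (((hP 1 (by norm_num)).sub ((hP (1 - 1) (by norm_num)).comp_sub_const 1 1)).const_mul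
        z).continuousAt
    exact h1.add h2
  -- hence it is constant on `[1, v]`
  have hconst : Ψ v = Ψ 1 := by
    rcases hv1.eq_or_lt with h | h
    · rw [h]
    · have hev : (fun _ => Ψ v) =ᶠ[𝓝[>] (1 : ℝ)] Ψ := by
        filter_upwards [Ioo_mem_nhdsGT h] with a ha
        have hcont : ContinuousOn Ψ (Icc a v) := fun x hx =>
          (hΨ0 x (ha.1.trans_le hx.1) (hx.2.trans hvb)).continuousAt.continuousWithinAt
        have hder : ∀ x ∈ Ico a v, HasDerivWithinAt Ψ 0 (Ici x) x := fun x hx =>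
          (hΨ0 x (ha.1.trans_le hx.1) (hx.2.le.trans hvb)).hasDerivWithinAt
        exact constant_of_has_deriv_right_zero hcont hder v ⟨ha.2.le, le_rfl⟩
      have ht1 : Tendsto Ψ (𝓝[>] (1 : ℝ)) (𝓝 (Ψ 1)) := hΨc.tendsto.mono_left nhdsWithin_le_nhds
      have ht2 : Tendsto Ψ (𝓝[>] (1 : ℝ)) (𝓝 (Ψ v)) := tendsto_const_nhds.congr' hev
      exact tendsto_nhds_unique ht2 ht1
  -- and its value at `v = 1` is the right-hand side (`K ≡ 1` on `[0, 1]`)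
  rw [hΦΨ v (by linarith), hconst, ← hΦΨ 1 one_pos, hK1 1 le_rfl, sub_self, Complex.ofReal_one, one_mul,
    one_mul]
  congr 2
  refine intervalIntegral.integral_congr fun t ht => ?_
  rw [uIcc_of_le zero_le_one] at ht
  simp only [hF]
  rw [hK1 t ht.2, one_mul]

/-! ## The row: continuity and the delay equation in the variable `v = τ − 1` -/

/-- The row `K = rowFn u z` is continuous (tree `DensityCalculus` (C5), `calc_continuous_modelEval`). -/
theorem mgInv_continuous_rowFn (u : ℕ) (z : ℂ) : Continuous (rowFn u z) :=
  (calc_continuous_modelEval u z).comp (continuous_add_const 1)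

/-- The delay equation of the row in the variable `v = τ − 1`: `K'(v) = z K(v−1)/v` for `1 < v ≤ u`, `u ≥ 2`
(tree `DensityCalculus` (C6), `calc_hasDerivAt_modelEval`, shifted by one). -/
theorem mgInv_hasDerivAt_rowFn {u : ℕ} (hu : 2 ≤ u) (z : ℂ) {v : ℝ} (hv : 1 < v) (hvu : v ≤ (u : ℝ)) :
    HasDerivAt (rowFn u z) (z * rowFn u z (v - 1) / (v : ℂ)) v := by
  have h := (calc_hasDerivAt_modelEval hu z (τ := v + 1) (by linarith) (by linarith)).comp_add_const v 1
  refine h.congr_deriv ?_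
  rw [rowFn, add_sub_right_comm]
  push_cast
  ring

/-! ## The registered stub -/

/-- **Stub `mg_invariantConst` (registered): constancy of the invariant `⟨K, g̃_z⟩` along the row.** For
`N ≥ 1`, `|z| ≤ N − 1`, `u ≥ 3` and `1 ≤ v ≤ u − 1`,
`v K(v) g̃_z(v) + z ∫_{v−1}^{v} K(t) g̃_z(t+1) dt = g̃_z(1) + z ∫_0^1 g̃_z(t+1) dt`, `K = rowFn u z`, from the
adjoint equation `MGAdjointEq` (hypothesis), the delay equation `v K' = z K(v−1)` (tree `DensityCalculus`
(C6)) and `K ≡ 1` on `(−∞, 1]` (`rowFn_eq_one`), through the abstract lemma `mgInv_invariant_eq`. -/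
theorem mg_invariantConst : MGAdjointEq → MGInvariantConst := by
  intro hA N hN z hz u hu v hv1 hvu
  exact mgInv_invariant_eq (b := (u : ℝ) - 1) (mgInv_continuous_rowFn u z)
    (fun t ht => rowFn_eq_one u (by omega) z t ht)
    (fun w hw hwb => mgInv_hasDerivAt_rowFn (by omega) z hw (by linarith)) (hA N hN z hz) hv1 hvu

end Summit.Parity.GeneralizedHardyLittlewood.Cruxes.AbsoluteUpgrade.DipMarginRateExchange

end
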